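import Summits.HodgeConjecture.CorCM.GaloisThirtyTwoClassTwoCertificate
import Summits.HodgeConjecture.CorCM.GaloisThirtyTwoFrattiniDegenerate
import Summits.HodgeConjecture.CorCM.GaloisThirtyTwoOrderEightBranch
import Summits.HodgeConjecture.CorCM.GaloisThirtyTwoStructOfPowFour
import Summits.HodgeConjecture.CorCM.GaloisThirtyTwoQuotientSixteen
import HarnessLib

/-!
# Degree `32`: a central involution `t ≠ c` with all squares in `{1, c, t, ct}` ⟹ BAD; GOOD with a second central involution ⟹ structured

COR-CM (cell `pub-hodgecm2`), binder seat b04 (gen 36), count-neutral own lane «Galois-CM-type classification».  KERNEL ONLY: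
theorems; no definition, no named fact, no `sorry`.  `HC_CM` is neither used nor claimed.  ORDER-`32` BASE programme (A7-JUNCTION
gen-36 addendum §E): the driver of the uniform class-two certificate (`CorCM/GaloisThirtyTwoClassTwoCertificate`).

* **`exists_simple_degenerate_of_sq_subset_four`** — `K` Galois CM of degree `32`, `t ∈ Gal(K/ℚ)` a central involution with
  `t ∉ {1, c}`, every `g` with `g² ∈ {1, c, t, ct}` ⟹ `K` has a primitive DEGENERATE CM type (a simple CM abelian `16`-fold with an
  exceptional Hodge class).  PROOF: if all squares lie in `{1, c}` this is `CorCM/GaloisThirtyTwoFrattiniDegenerate`; otherwise some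
  `x₁ ∉ V = {1,c,t,ct}` has `x₁² ∈ {t, ct}` — after `t ↔ ct`, `x₁² = t`; complete `x₁` by `x₂ ∉ x₁^{0,1}V`, `x₃ ∉ ⟨x₁,x₂⟩V` (counting:
  `8, 16 < 32`); all squares, hence all commutators, lie in the central four-group `V`, so `Gal(K/ℚ)` is the class-two table of
  `CorCM/TwoGroupClassTwoTable` and the ONE certificate of `CorCM/GaloisThirtyTwoClassTwoCertificate` applies — whatever the group.
  This is the first alternative of the pulled-back GOOD16 dichotomy (`CorCM/GaloisThirtyTwoQuotientSixteen`), so: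
* **`struct_of_central_involution`** — `K` GOOD of degree `32` with a central involution `t ∉ {1, c}` ⟹ STRUCTURED
  (`Gal = H × E`, `H` cyclic or generalised quaternion `∋ c`, `|E| ≤ 2`): the second alternative is `CorCM/GaloisThirtyTwoOrderEightBranch`
  (`struct_of_order_eight_pullback_of_central`) or the abelian case.  This SUPERSEDES the capstone of
  `CorCM/GaloisThirtyTwoStructOfCentralInvolutions` (no residual configuration, no hypothesis on non-central involutions): PART I of
  the order-`32` base and the whole «case B» of PART II are closed.
* **`struct_thirtytwo_of_minimal_case`** — the order-`32` base `STRUCT(32)` of `CorCM/GaloisTwoPowerClassification` is reduced to the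
  MINIMAL fields of degree `32` (those whose only central involutions are `1, c`, i.e. with no proper Galois CM subfield; by the census:
  `Gal ∈ {C₃₂, Q₃₂}` structured, `2^{1+4}_±`, `D₃₂, SD₃₂, M₃₂` (files of this generation) and nine groups of exponent `8`/`4` still open).

## References

* [Shimura1998] G. Shimura, *Abelian Varieties with Complex Multiplication and Modular Functions*, §6.2 Thm. 3, §8.2 Prop. 26.
* [Gordon1999HodgeAVSurvey] B. B. Gordon, *A survey of the Hodge conjecture for abelian varieties*, Thm. 6.4, §9.3–9.4.
* [Dodson1984] B. Dodson, *The structure of Galois groups of CM-fields*, Trans. AMS 283 (1984), §3.3, §5.2.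
* [Rotman1995] J. J. Rotman, *An Introduction to the Theory of Groups*, 4th ed., GTM 148, Ch. 5, Thm. 5.46.
-/

noncomputable section

open CategoryTheory CategoryTheory.Limits NumberField
open scoped BigOperators

namespace Summit.HodgeConjecture.CorCM.GaloisModels

open Literature.NumberTheory.ComplexMultiplication
open Literature.AlgebraicGeometry.Motives (AbelianVariety CMType)
open Literature.AlgebraicGeometry.HodgeTheory
open Literature.AlgebraicGeometry.ComplexMultiplication (IsCMTypeRealisation)
open Literature.AlgebraicGeometry.Pohlmann1968
open Literature.Barriers.HodgeConjecture (divisorClassesSpan)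
open Summit.HodgeConjecture.CorCM.GaloisRank
open Summit.HodgeConjecture.CorCM.GaloisTableLaws (zmod2_cases)
open Summit.HodgeConjecture.CorCM.GaloisModels.FrattiniTwo (invol_pow_add)

section Field

variable {K : Type} [Field K] [NumberField K] [IsCMField K] [IsGalois ℚ K]

/-! ## §1 The class-two world is BAD -/

/-- **Squares in `V = {1,c,t,ct}` and some `x₁ ∉ V` with `x₁² = t^b` ⟹ a primitive DEGENERATE CM type.**  `K` Galois CM of degree
`32`, `t` a central involution with `t ∉ {1, c}`, all squares in `V`; `x₁ ∉ V` (word form) with `x₁² ∈ {1, t}`.  The elements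
`x₂ ∉ x₁^{0,1}V` and `x₃ ∉ ⟨x₁, x₂⟩V` exist by counting, all commutators lie in `V`, and the uniform class-two certificate applies.
[cite: Shimura1998, §6.2 Thm. 3 and §8.2 Prop. 26] [cite: Gordon1999HodgeAVSurvey, Thm. 6.4 and §9.3] -/
theorem exists_simple_degenerate_of_sq_subset_four_of_sq (hdeg : Module.finrank ℚ K = 32) (t x₁ : K ≃ₐ[ℚ] K)
    (htt : t * t = 1) (ht1 : t ≠ 1) (htc : t ≠ (IsCMField.complexConj K).restrictScalars ℚ)
    (htcen : ∀ g : K ≃ₐ[ℚ] K, g * t = t * g)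
    (hsq : ∀ g : K ≃ₐ[ℚ] K, g * g = 1 ∨ g * g = (IsCMField.complexConj K).restrictScalars ℚ ∨ g * g = t ∨
      g * g = (IsCMField.complexConj K).restrictScalars ℚ * t)
    (b : ZMod 2) (hq1 : x₁ * x₁ = t ^ b.val)
    (h1 : ∀ d₁ d₂ : ZMod 2, x₁ * (IsCMField.complexConj K).restrictScalars ℚ ^ d₁.val * t ^ d₂.val ≠ 1) :
    ∃ (Φ : CMType K) (φ : K →+* ℂ) (X : AbelianVariety ℂ) (ι : 𝓞 K →+* End X)
      (ϑ : K →+* Module.End ℂ (complexBetti X.X 1)),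
      IsPrimitive (ℂ ≃+* ℂ) Φ.1 φ ∧ ¬ IsNondegenerate Φ ∧ IsCMTypeRealisation Φ X ι ϑ ∧ X.IsSimple ∧ X.dim = 16 ∧
      ∃ m p : ℕ, ∃ z : complexBetti (⨁ fun _ : Fin m => X).X (2 * p), IsRationalClass z ∧
        IsOfHodgeType (⨁ fun _ : Fin m => X).dim (⨁ fun _ : Fin m => X).X (2 * p) p p z ∧
        z ∉ divisorClassesSpan (⨁ fun _ : Fin m => X).X (⨁ fun _ : Fin m => X).dim p := by
  classical
  set c := (IsCMField.complexConj K).restrictScalars ℚ with hc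
  have hcc : c * c = 1 := model_complexConj_mul_self (MulEquiv.refl (K ≃ₐ[ℚ] K)) (by simp [hc])
  have hcen : ∀ g : K ≃ₐ[ℚ] K, c * g = g * c := fun g =>
    model_complexConj_comm (MulEquiv.refl (K ≃ₐ[ℚ] K)) (by simp [hc]) g
  have hcard : Nat.card (K ≃ₐ[ℚ] K) = 32 := by
    rw [Nat.card_eq_fintype_card, card_model_eq_finrank (MulEquiv.refl (K ≃ₐ[ℚ] K)), hdeg]
  have hcard' : Fintype.card (K ≃ₐ[ℚ] K) = 32 := by rw [← Nat.card_eq_fintype_card, hcard]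
  have htcen' : ∀ g : K ≃ₐ[ℚ] K, t * g = g * t := fun g => (htcen g).symm
  have hv0 : (0 : ZMod 2).val = 0 := rfl
  have hv1 : (1 : ZMod 2).val = 1 := rfl
  -- the four-group `V = {c^γ t^δ}`: squares, centrality, products, inverses
  have hVsq : ∀ g : K ≃ₐ[ℚ] K, ∃ γ δ : ZMod 2, g * g = c ^ γ.val * t ^ δ.val := by
    intro g
    rcases hsq g with h | h | h | h
    · exact ⟨0, 0, by rw [h, hv0, pow_zero, pow_zero, one_mul]⟩
    · exact ⟨1, 0, by rw [h, hv1, hv0, pow_one, pow_zero, mul_one]⟩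
    · exact ⟨0, 1, by rw [h, hv0, hv1, pow_zero, pow_one, one_mul]⟩
    · exact ⟨1, 1, by rw [h, hv1, pow_one, pow_one]⟩
  have hVcen : ∀ (γ δ : ZMod 2) (g : K ≃ₐ[ℚ] K), c ^ γ.val * t ^ δ.val * g = g * (c ^ γ.val * t ^ δ.val) := by
    intro γ δ g
    have h₁ : Commute (c ^ γ.val) g := (show Commute c g from hcen g).pow_left γ.val
    have h₂ : Commute (t ^ δ.val) g := (show Commute t g from htcen' g).pow_left δ.val
    exact (h₁.mul_left h₂).eq
  have hVmul : ∀ γ δ γ' δ' : ZMod 2,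
      c ^ γ.val * t ^ δ.val * (c ^ γ'.val * t ^ δ'.val) = c ^ (γ + γ').val * t ^ (δ + δ').val := by
    intro γ δ γ' δ'
    have hct : t ^ δ.val * c ^ γ'.val = c ^ γ'.val * t ^ δ.val := ((show Commute t c from htcen' c).pow_pow _ _).eq
    calc c ^ γ.val * t ^ δ.val * (c ^ γ'.val * t ^ δ'.val) = c ^ γ.val * (t ^ δ.val * c ^ γ'.val) * t ^ δ'.val := by
          simp only [mul_assoc]
      _ = c ^ γ.val * (c ^ γ'.val * t ^ δ.val) * t ^ δ'.val := by rw [hct]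
      _ = (c ^ γ.val * c ^ γ'.val) * (t ^ δ.val * t ^ δ'.val) := by simp only [mul_assoc]
      _ = c ^ (γ + γ').val * t ^ (δ + δ').val := by rw [← invol_pow_add hcc, ← invol_pow_add htt]
  have h2z : ∀ x : ZMod 2, x + x = 0 := by decide
  have hVV : ∀ γ δ : ZMod 2, c ^ γ.val * t ^ δ.val * (c ^ γ.val * t ^ δ.val) = 1 := by
    intro γ δ
    rw [hVmul, h2z, h2z, hv0, pow_zero, pow_zero, one_mul]
  have hVinv : ∀ γ δ : ZMod 2, (c ^ γ.val * t ^ δ.val)⁻¹ = c ^ γ.val * t ^ δ.val := fun γ δ =>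
    inv_eq_of_mul_eq_one_right (hVV γ δ)
  -- commutators lie in `V`
  have hcomm : ∀ g h : K ≃ₐ[ℚ] K, ∃ γ δ : ZMod 2, h * g = g * h * (c ^ γ.val * t ^ δ.val) := by
    intro g h
    obtain ⟨γ₁, δ₁, hgh⟩ := hVsq (g * h)
    obtain ⟨γ₂, δ₂, hgg⟩ := hVsq g
    obtain ⟨γ₃, δ₃, hhh⟩ := hVsq h
    have hc3 : h * h * g = g * (h * h) := by rw [hhh]; exact hVcen γ₃ δ₃ g
    have key : h * g = g * h * (((g * h) * (g * h))⁻¹ * ((g * g) * (h * h))) := by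
      calc h * g = (g * h)⁻¹ * ((g * h) * (h * g)) := by group
        _ = (g * h)⁻¹ * (g * (h * h * g)) := by simp only [mul_assoc]
        _ = (g * h)⁻¹ * (g * (g * (h * h))) := by rw [hc3]
        _ = g * h * (((g * h) * (g * h))⁻¹ * ((g * g) * (h * h))) := by group
    refine ⟨γ₁ + (γ₂ + γ₃), δ₁ + (δ₂ + δ₃), ?_⟩
    rw [key, hgh, hgg, hhh, hVinv, hVmul, hVmul]
  -- `x₂ ∉ x₁^{0,1} V`
  set S₁ : Finset (K ≃ₐ[ℚ] K) := (Finset.univ : Finset (ZMod 2 × ZMod 2 × ZMod 2)).image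
    fun p => (x₁ ^ p.1.val * c ^ p.2.1.val * t ^ p.2.2.val)⁻¹ with hS₁
  have hx₂ : ∃ x₂ : K ≃ₐ[ℚ] K, x₂ ∉ S₁ := by
    by_contra hall
    push Not at hall
    have hle : (Finset.univ : Finset (K ≃ₐ[ℚ] K)).card ≤ S₁.card := Finset.card_le_card fun x _ => hall x
    have h8 : S₁.card ≤ 8 := Finset.card_image_le.trans (by simp [Fintype.card_prod, ZMod.card])
    rw [Finset.card_univ, hcard'] at hle
    omega
  obtain ⟨x₂, hx₂⟩ := hx₂
  have h2 : ∀ a d₁ d₂ : ZMod 2, x₁ ^ a.val * x₂ * c ^ d₁.val * t ^ d₂.val ≠ 1 := by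
    intro a d₁ d₂ h
    apply hx₂
    rw [hS₁, Finset.mem_image]
    refine ⟨(a, d₁, d₂), Finset.mem_univ _, ?_⟩
    have h' : x₁ ^ a.val * c ^ d₁.val * t ^ d₂.val * x₂ = 1 := by
      calc x₁ ^ a.val * c ^ d₁.val * t ^ d₂.val * x₂ = x₁ ^ a.val * (c ^ d₁.val * t ^ d₂.val * x₂) := by
            simp only [mul_assoc]
        _ = x₁ ^ a.val * (x₂ * (c ^ d₁.val * t ^ d₂.val)) := by rw [hVcen d₁ d₂ x₂]
        _ = x₁ ^ a.val * x₂ * c ^ d₁.val * t ^ d₂.val := by simp only [mul_assoc]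
        _ = 1 := h
    exact (eq_inv_of_mul_eq_one_right h').symm
  -- `x₃ ∉ ⟨x₁, x₂⟩ V`
  set S₂ : Finset (K ≃ₐ[ℚ] K) := (Finset.univ : Finset (ZMod 2 × ZMod 2 × ZMod 2 × ZMod 2)).image
    fun p => (x₁ ^ p.1.val * x₂ ^ p.2.1.val * c ^ p.2.2.1.val * t ^ p.2.2.2.val)⁻¹ with hS₂
  have hx₃ : ∃ x₃ : K ≃ₐ[ℚ] K, x₃ ∉ S₂ := by
    by_contra hall
    push Not at hall
    have hle : (Finset.univ : Finset (K ≃ₐ[ℚ] K)).card ≤ S₂.card := Finset.card_le_card fun x _ => hall x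
    have h16 : S₂.card ≤ 16 := Finset.card_image_le.trans (by simp [Fintype.card_prod, ZMod.card])
    rw [Finset.card_univ, hcard'] at hle
    omega
  obtain ⟨x₃, hx₃⟩ := hx₃
  have h3 : ∀ a a' d₁ d₂ : ZMod 2, x₁ ^ a.val * x₂ ^ a'.val * x₃ * c ^ d₁.val * t ^ d₂.val ≠ 1 := by
    intro a a' d₁ d₂ h
    apply hx₃
    rw [hS₂, Finset.mem_image]
    refine ⟨(a, a', d₁, d₂), Finset.mem_univ _, ?_⟩
    have h' : x₁ ^ a.val * x₂ ^ a'.val * c ^ d₁.val * t ^ d₂.val * x₃ = 1 := by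
      calc x₁ ^ a.val * x₂ ^ a'.val * c ^ d₁.val * t ^ d₂.val * x₃ =
          x₁ ^ a.val * x₂ ^ a'.val * (c ^ d₁.val * t ^ d₂.val * x₃) := by simp only [mul_assoc]
        _ = x₁ ^ a.val * x₂ ^ a'.val * (x₃ * (c ^ d₁.val * t ^ d₂.val)) := by rw [hVcen d₁ d₂ x₃]
        _ = x₁ ^ a.val * x₂ ^ a'.val * x₃ * c ^ d₁.val * t ^ d₂.val := by simp only [mul_assoc]
        _ = 1 := h
    exact (eq_inv_of_mul_eq_one_right h').symm
  -- the parameters and the certificate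
  obtain ⟨α₂, β₂, hq2⟩ := hVsq x₂
  obtain ⟨α₃, β₃, hq3⟩ := hVsq x₃
  obtain ⟨γ₁, δ₁, hk21⟩ := hcomm x₁ x₂
  obtain ⟨γ₂, δ₂, hk31⟩ := hcomm x₁ x₃
  obtain ⟨γ₃, δ₃, hk32⟩ := hcomm x₂ x₃
  exact exists_simple_degenerate_of_classtwo hdeg b α₂ β₂ α₃ β₃ γ₁ δ₁ γ₂ δ₂ γ₃ δ₃ t x₁ x₂ x₃ htt ht1 htc htcen' hq1
    hq2 hq3 hk21 hk31 hk32 h1 h2 h3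

/-- **A central involution `t ≠ c` with all squares in `{1, c, t, ct}` ⟹ a primitive DEGENERATE CM type** (`[K:ℚ] = 32`; no other
hypothesis: the first alternative of the pulled-back GOOD16 dichotomy never occurs for a GOOD field of degree `32`).  If all squares
lie in `{1, c}` this is `exists_simple_degenerate_of_sq_subset`; otherwise some `x ∉ V` has `x² ∈ {t, ct}` and, after `t ↔ ct`,
`exists_simple_degenerate_of_sq_subset_four_of_sq` applies. [cite: Shimura1998, §6.2 Thm. 3 and §8.2 Prop. 26]
[cite: Gordon1999HodgeAVSurvey, Thm. 6.4 and §9.3] [cite: Dodson1984, §3.3 and §5.2] -/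
theorem exists_simple_degenerate_of_sq_subset_four (hdeg : Module.finrank ℚ K = 32) (t : K ≃ₐ[ℚ] K)
    (htt : t * t = 1) (ht1 : t ≠ 1) (htc : t ≠ (IsCMField.complexConj K).restrictScalars ℚ)
    (htcen : ∀ g : K ≃ₐ[ℚ] K, g * t = t * g)
    (hsq : ∀ g : K ≃ₐ[ℚ] K, g * g = 1 ∨ g * g = (IsCMField.complexConj K).restrictScalars ℚ ∨ g * g = t ∨
      g * g = (IsCMField.complexConj K).restrictScalars ℚ * t) :
    ∃ (Φ : CMType K) (φ : K →+* ℂ) (X : AbelianVariety ℂ) (ι : 𝓞 K →+* End X)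
      (ϑ : K →+* Module.End ℂ (complexBetti X.X 1)),
      IsPrimitive (ℂ ≃+* ℂ) Φ.1 φ ∧ ¬ IsNondegenerate Φ ∧ IsCMTypeRealisation Φ X ι ϑ ∧ X.IsSimple ∧ X.dim = 16 ∧
      ∃ m p : ℕ, ∃ z : complexBetti (⨁ fun _ : Fin m => X).X (2 * p), IsRationalClass z ∧
        IsOfHodgeType (⨁ fun _ : Fin m => X).dim (⨁ fun _ : Fin m => X).X (2 * p) p p z ∧
        z ∉ divisorClassesSpan (⨁ fun _ : Fin m => X).X (⨁ fun _ : Fin m => X).dim p := by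
  classical
  set c := (IsCMField.complexConj K).restrictScalars ℚ with hc
  have hcc : c * c = 1 := model_complexConj_mul_self (MulEquiv.refl (K ≃ₐ[ℚ] K)) (by simp [hc])
  have hcen : ∀ g : K ≃ₐ[ℚ] K, c * g = g * c := fun g =>
    model_complexConj_comm (MulEquiv.refl (K ≃ₐ[ℚ] K)) (by simp [hc]) g
  have hv1 : (1 : ZMod 2).val = 1 := rfl
  by_cases hall : ∀ g : K ≃ₐ[ℚ] K, g * g = 1 ∨ g * g = c
  · exact exists_simple_degenerate_of_sq_subset hdeg hall
  push Not at hall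
  obtain ⟨g, hg1, hgc⟩ := hall
  have hct : Commute c t := (htcen c)
  -- `V`-elements are involutions, so `g ∉ V`
  have hVV : ∀ d₁ d₂ : ZMod 2, c ^ d₁.val * t ^ d₂.val * (c ^ d₁.val * t ^ d₂.val) = 1 := by
    intro d₁ d₂
    have hct' : t ^ d₂.val * c ^ d₁.val = c ^ d₁.val * t ^ d₂.val := ((hct.symm).pow_pow _ _).eq
    calc c ^ d₁.val * t ^ d₂.val * (c ^ d₁.val * t ^ d₂.val) = c ^ d₁.val * (t ^ d₂.val * c ^ d₁.val) * t ^ d₂.val := by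
          simp only [mul_assoc]
      _ = c ^ d₁.val * (c ^ d₁.val * t ^ d₂.val) * t ^ d₂.val := by rw [hct']
      _ = (c ^ d₁.val * c ^ d₁.val) * (t ^ d₂.val * t ^ d₂.val) := by simp only [mul_assoc]
      _ = 1 := by
          rw [← pow_add, ← pow_add, ← two_mul, ← two_mul, pow_mul, pow_mul, pow_two, pow_two, hcc, htt, one_pow,
            one_pow, one_mul]
  have hgV : ∀ d₁ d₂ : ZMod 2, g * c ^ d₁.val * t ^ d₂.val ≠ 1 := by
    intro d₁ d₂ h
    apply hg1
    have hg : g = (c ^ d₁.val * t ^ d₂.val)⁻¹ := eq_inv_of_mul_eq_one_left (by rw [← h]; simp only [mul_assoc])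
    rw [hg, ← mul_inv_rev, hVV, inv_one]
  rcases hsq g with h | h | h | h
  · exact absurd h hg1
  · exact absurd h hgc
  · exact exists_simple_degenerate_of_sq_subset_four_of_sq hdeg t g htt ht1 htc htcen hsq 1 (by rw [h, hv1, pow_one]) hgV
  · -- `g² = ct`: run the previous theorem with `t' = ct`
    have hct1 : c * t ≠ 1 := fun h' => htc (by
      rw [eq_inv_of_mul_eq_one_right h']
      exact inv_eq_of_mul_eq_one_right hcc)
    have hctc : c * t ≠ c := fun h' => ht1 (mul_left_cancel (h'.trans (mul_one c).symm))
    have hctt : c * t * (c * t) = 1 := by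
      calc c * t * (c * t) = c * (t * c) * t := by simp only [mul_assoc]
        _ = c * (c * t) * t := by rw [hct.eq]
        _ = (c * c) * (t * t) := by simp only [mul_assoc]
        _ = 1 := by rw [hcc, htt, one_mul]
    have hctcen : ∀ g' : K ≃ₐ[ℚ] K, g' * (c * t) = c * t * g' := fun g' => by
      rw [← mul_assoc, ← hcen g', mul_assoc, htcen g', ← mul_assoc]
    have hcct : c * (c * t) = t := by rw [← mul_assoc, hcc, one_mul]
    have hsq' : ∀ g' : K ≃ₐ[ℚ] K, g' * g' = 1 ∨ g' * g' = c ∨ g' * g' = c * t ∨ g' * g' = c * (c * t) := by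
      intro g'
      rw [hcct]
      rcases hsq g' with h' | h' | h' | h'
      · exact Or.inl h'
      · exact Or.inr (Or.inl h')
      · exact Or.inr (Or.inr (Or.inr h'))
      · exact Or.inr (Or.inr (Or.inl h'))
    have hgV' : ∀ d₁ d₂ : ZMod 2, g * c ^ d₁.val * (c * t) ^ d₂.val ≠ 1 := by
      intro d₁ d₂
      rw [hct.mul_pow, ← mul_assoc, mul_assoc g, ← invol_pow_add hcc]
      exact hgV (d₁ + d₂) d₂
    exact exists_simple_degenerate_of_sq_subset_four_of_sq hdeg (c * t) g hctt hct1 hctc hctcen hsq' 1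
      (by rw [h, hv1, pow_one]) hgV'

/-! ## §2 GOOD with a second central involution ⟹ structured -/

/-- **GOOD Galois CM fields of degree `32` with a central involution `t ∉ {1, c}` are STRUCTURED**: `Gal(K/ℚ) = H × E` with `H ∋ c`
cyclic or generalised quaternion and `|E| ≤ 2` (so `Gal ∈ {C₃₂?, C₁₆ × C₂, Q₁₆ × C₂}` — by the census exactly `C₁₆ × C₂` with
`c ∈ C₁₆` and `Q₁₆ × C₂` with `c ∈ Q₁₆`).  The GOOD degree-`16` CM quotient `K^⟨t⟩` gives the dichotomy of
`sq_mem_or_exists_order_eight_of_central_involution`; its first alternative is BAD (`exists_simple_degenerate_of_sq_subset_four`), its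
second is `struct_of_order_eight_pullback_of_central` (or the abelian case).  No hypothesis on the other involutions: this closes
PART I of the order-`32` base (all involutions central, `Ω₁(Z) ≠ ⟨c⟩`) including the residual configuration of
`struct_of_involutions_central`, and the «case B» half of PART II. [cite: Dodson1984, §3.3 and §5.2]
[cite: Shimura1998, §6.2 Thm. 3 and §8.2 Prop. 26] [cite: Gordon1999HodgeAVSurvey, Thm. 6.4 and §9.4] [cite: Rotman1995, Thm. 5.46] -/
theorem struct_of_central_involution (hdeg : Module.finrank ℚ K = 32)
    (hgood : ∀ (Φ : CMType K) (φ : K →+* ℂ), IsPrimitive (ℂ ≃+* ℂ) Φ.1 φ → IsNondegenerate Φ)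
    (t : K ≃ₐ[ℚ] K) (htt : t * t = 1) (ht1 : t ≠ 1) (htc : t ≠ (IsCMField.complexConj K).restrictScalars ℚ)
    (htcen : ∀ g : K ≃ₐ[ℚ] K, g * t = t * g) :
    ∃ (H E : Subgroup (K ≃ₐ[ℚ] K)) (k : ℕ), H.IsComplement' E ∧ (IsCMField.complexConj K).restrictScalars ℚ ∈ H ∧
      (IsCMField.complexConj K).restrictScalars ℚ ∉ E ∧ (∀ e ∈ E, e * e = 1 ∧ ∀ g : K ≃ₐ[ℚ] K, g * e = e * g) ∧
      Nat.card E ≤ 2 ∧ Nat.card H = 2 ^ k ∧ (IsCyclic H ∨ (3 ≤ k ∧ Nonempty (H ≃* QuaternionGroup (2 ^ (k - 2))))) := by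
  classical
  rcases sq_mem_or_exists_order_eight_of_central_involution hdeg hgood t htt ht1 htc htcen with hsq | ⟨r, hr8, hr4, hconj⟩
  · obtain ⟨Φ, φ, X, ι, ϑ, H1, H2, -⟩ := exists_simple_degenerate_of_sq_subset_four hdeg t htt ht1 htc htcen hsq
    exact (H2 (hgood Φ φ H1)).elim
  · by_cases hab : ∀ g h : K ≃ₐ[ℚ] K, g * h = h * g
    · exact struct_of_comm_thirtytwo hdeg hgood hab
    · push Not at hab
      obtain ⟨g, h, hgh⟩ := hab
      exact struct_of_order_eight_pullback_of_central hdeg hgood t htt ht1 htc htcen r hr8 hr4 hconj ⟨g, h, hgh⟩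

/-- **The order-`32` base is reduced to the minimal fields.**  For a GOOD Galois CM field `K` of degree `32`: if STRUCT holds under
the extra hypothesis that `1` and `c` are the only central involutions of `Gal(K/ℚ)` (no proper Galois CM subfield), then STRUCT
holds.  (With `struct_of_central_involution` for the other case.)  What remains of `STRUCT(32)`: the minimal fields whose group is
neither of exponent `≥ 16` (`CorCM/GaloisThirtyTwoOrderSixteenBranch`, `struct_of_involution_unique`) nor of Frattini `≤ ⟨c⟩`
(`CorCM/GaloisThirtyTwoFrattiniDegenerate`) — nine groups of the census. [cite: Dodson1984, §3.3 and §5.2]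
[cite: Gordon1999HodgeAVSurvey, Thm. 6.4 and §9.4] -/
theorem struct_thirtytwo_of_minimal_case (hdeg : Module.finrank ℚ K = 32)
    (hgood : ∀ (Φ : CMType K) (φ : K →+* ℂ), IsPrimitive (ℂ ≃+* ℂ) Φ.1 φ → IsNondegenerate Φ)
    (hmin : (∀ s : K ≃ₐ[ℚ] K, s * s = 1 → (∀ g : K ≃ₐ[ℚ] K, g * s = s * g) →
        s = 1 ∨ s = (IsCMField.complexConj K).restrictScalars ℚ) →
      ∃ (H E : Subgroup (K ≃ₐ[ℚ] K)) (k : ℕ), H.IsComplement' E ∧ (IsCMField.complexConj K).restrictScalars ℚ ∈ H ∧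
        (IsCMField.complexConj K).restrictScalars ℚ ∉ E ∧ (∀ e ∈ E, e * e = 1 ∧ ∀ g : K ≃ₐ[ℚ] K, g * e = e * g) ∧
        Nat.card E ≤ 2 ∧ Nat.card H = 2 ^ k ∧ (IsCyclic H ∨ (3 ≤ k ∧ Nonempty (H ≃* QuaternionGroup (2 ^ (k - 2)))))) :
    ∃ (H E : Subgroup (K ≃ₐ[ℚ] K)) (k : ℕ), H.IsComplement' E ∧ (IsCMField.complexConj K).restrictScalars ℚ ∈ H ∧
      (IsCMField.complexConj K).restrictScalars ℚ ∉ E ∧ (∀ e ∈ E, e * e = 1 ∧ ∀ g : K ≃ₐ[ℚ] K, g * e = e * g) ∧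
      Nat.card E ≤ 2 ∧ Nat.card H = 2 ^ k ∧ (IsCyclic H ∨ (3 ≤ k ∧ Nonempty (H ≃* QuaternionGroup (2 ^ (k - 2))))) := by
  by_cases h : ∀ s : K ≃ₐ[ℚ] K, s * s = 1 → (∀ g : K ≃ₐ[ℚ] K, g * s = s * g) →
      s = 1 ∨ s = (IsCMField.complexConj K).restrictScalars ℚ
  · exact hmin h
  · push Not at h
    obtain ⟨s, hss, hscen, hs1, hsc⟩ := h
    exact struct_of_central_involution hdeg hgood s hss hs1 hsc hscen

end Field

end Summit.HodgeConjecture.CorCM.GaloisModels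

end
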